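import Mathlib.Algebra.CharP.Lemmas
import Mathlib.Algebra.CharP.Reduced
import Mathlib.RingTheory.Nilpotent.Basic
import Mathlib.LinearAlgebra.Basis.Basic
import Literature.NumberTheory.GaloisCohomology.FrobeniusDeRham
import HarnessLib

/-!
# Finite `p`-bases of a ring of characteristic `p`

For a commutative ring `R` of prime characteristic `p`, a finite family `t : ι → R` is a **`p`-basis** when
the `p`-monomials `t^α = ∏ i, t i ^ α i` (`α : ι → Fin p`, exponents `0 ≤ α i < p`) form a basis of `R` over
`R^p`, i.e. every `x : R` is UNIQUELY `x = ∑_α c_α ^ p * t^α`.  We phrase this with the Frobenius twist of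
`FrobeniusDeRham.lean`: `FrobeniusTwist p R R` is `R` with the scalar action `c • x = c ^ p * x`, and `t` is a
`p`-basis iff `α ↦ t^α` is an `R`-basis of `FrobeniusTwist p R R` (`IsPBasis p t`).

This is the hypothesis under which the de Rham complex of `R` decomposes monomially and the Cartier
isomorphism holds (Illusie; Matsumura §26 for fields: a `p`-basis is a differential basis); localizations of
smooth algebras over perfect fields and finitely generated fields over perfect fields have finite `p`-bases.

## Contents

* `pMonomial p t α = ∏ i, t i ^ (α i : ℕ)` and its image `pMonomialTwist p t α` in `FrobeniusTwist p R R`;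
* `pCarry p t α β = ∏ i, (t i if p ≤ α i + β i else 1)` and the MULTIPLICATION TABLE
  `pMonomial p t α * pMonomial p t β = pCarry p t α β ^ p * pMonomial p t (α + β)` (`pMonomial_mul`);
* `IsPBasis p t` (linear independence + spanning of the `p`-monomials in the twist), the basis
  `IsPBasis.basis`, `basis_apply`, the expansion `x = ∑ α, (coord x α) ^ p * t^α` (`sum_coord_pow_mul_pMonomial`),
  an induction principle (`IsPBasis.induction_on`), extensionality of twisted-linear maps on `p`-monomials, and
  REDUCEDNESS: a ring with a `p`-basis has injective Frobenius (`IsPBasis.frobenius_injective`, `isReduced`).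

## References

* H. Matsumura, *Commutative Ring Theory*, CUP 1986, §26 (p-bases, Thm. 26.5). [Matsumura1987]
* L. Illusie, *Complexe de de Rham–Witt et cohomologie cristalline*, Ann. Sci. ÉNS 12 (1979), 0.2.1. [Illusie1979]
-/

noncomputable section

open scoped BigOperators

namespace Literature.NumberTheory.GaloisCohomology

universe u v

variable (p : ℕ) [hp : Fact p.Prime] {R : Type u} [CommRing R] [CharP R p] {ι : Type v} [Fintype ι]

/-! ### `p`-monomials and their multiplication table -/

/-- The `p`-monomial `t^α = ∏ i, t i ^ (α i)` of a finite family `t : ι → R`, exponents `α i : Fin p`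
(`0 ≤ α i < p`). [cite: Matsumura1987, §26] -/
def pMonomial (t : ι → R) (α : ι → Fin p) : R :=
  ∏ i, t i ^ (α i : ℕ)

/-- The `p`-monomial `t^α` as an element of the Frobenius twist `FrobeniusTwist p R R` (`R` with `c • x = c^p x`).
[cite: Matsumura1987, §26] -/
def pMonomialTwist (t : ι → R) (α : ι → Fin p) : FrobeniusTwist p R R :=
  FrobeniusTwist.of p R (pMonomial p t α)

omit hp [CharP R p] in
/-- `t^0 = 1`. [folklore] -/
@[simp] theorem pMonomial_zero' (t : ι → R) (α : ι → Fin p) (h : ∀ i, (α i : ℕ) = 0) : pMonomial p t α = 1 := by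
  unfold pMonomial
  exact Finset.prod_eq_one fun i _ => by rw [h i, pow_zero]

omit [CharP R p] in
/-- `t^0 = 1`. [folklore] -/
@[simp] theorem pMonomial_zero (t : ι → R) : pMonomial p t 0 = 1 :=
  pMonomial_zero' p t 0 fun _ => rfl

/-- The CARRY of the product of two `p`-monomials: `∏ i, (t i if p ≤ α i + β i else 1)`. [folklore] -/
def pCarry (t : ι → R) (α β : ι → Fin p) : R :=
  ∏ i, if p ≤ (α i : ℕ) + β i then t i else 1

omit [CharP R p] in
/-- One-variable carry: `t ^ (a + b) = (t if p ≤ a + b else 1) ^ p * t ^ ((a + b) % p)` for `a, b < p`.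
[folklore] -/
theorem pow_val_add_val (t : R) (a b : Fin p) :
    t ^ ((a : ℕ) + b) = (if p ≤ (a : ℕ) + b then t else 1) ^ p * t ^ ((a + b : Fin p) : ℕ) := by
  rw [Fin.val_add]
  split_ifs with h
  · conv_lhs => rw [← Nat.div_add_mod ((a : ℕ) + b) p]
    have hlt : (a : ℕ) + b < 2 * p := by have := a.2; have := b.2; omega
    have hq : ((a : ℕ) + b) / p = 1 := by
      rw [Nat.div_eq_iff hp.out.pos]
      constructor <;> omega
    rw [hq, mul_one, pow_add]
  · rw [one_pow, one_mul, Nat.mod_eq_of_lt (by omega)]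

omit [CharP R p] in
/-- **Multiplication table of `p`-monomials**: `t^α * t^β = (carry)^p * t^(α+β)` (exponents added in `Fin p`,
i.e. modulo `p`; the carries `t i ^ p` are `p`-th powers, hence "scalars" of the twist). [folklore] -/
theorem pMonomial_mul (t : ι → R) (α β : ι → Fin p) :
    pMonomial p t α * pMonomial p t β = pCarry p t α β ^ p * pMonomial p t (α + β) := by
  unfold pMonomial pCarry
  rw [← Finset.prod_mul_distrib, ← Finset.prod_pow, ← Finset.prod_mul_distrib]
  refine Finset.prod_congr rfl fun i _ => ?_
  rw [← pow_add, pow_val_add_val p (t i) (α i) (β i), Pi.add_apply]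

/-- Multiplication table in the twist: `t^α * t^β`, viewed in `FrobeniusTwist p R R`, is
`(pCarry α β) • t^(α+β)`. [folklore] -/
theorem of_pMonomial_mul (t : ι → R) (α β : ι → Fin p) :
    FrobeniusTwist.of p R (pMonomial p t α * pMonomial p t β) =
      pCarry p t α β • pMonomialTwist p t (α + β) := by
  rw [pMonomial_mul, pMonomialTwist, FrobeniusTwist.smul_of, smul_eq_mul]

/-- The twisted scalar action on `FrobeniusTwist p R R` is `c • of x = of (c ^ p * x)`. [folklore] -/
theorem FrobeniusTwist.smul_of_eq_of_pow_mul (c x : R) :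
    c • FrobeniusTwist.of p R x = FrobeniusTwist.of p R (c ^ p * x) := by
  rw [FrobeniusTwist.smul_of, smul_eq_mul]

/-! ### `p`-bases -/

/-- **A finite `p`-basis** of a ring `R` of characteristic `p`: a finite family `t : ι → R` whose `p`-monomials
`t^α` (`α : ι → Fin p`) form an `R`-basis of the Frobenius twist `FrobeniusTwist p R R` — i.e. every `x : R` is
uniquely `∑_α c_α ^ p * t^α`. [cite: Matsumura1987, §26] -/
structure IsPBasis (t : ι → R) : Prop where
  /-- the `p`-monomials are linearly independent over `R` acting through Frobenius -/
  linearIndependent : LinearIndependent R (pMonomialTwist p t)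
  /-- the `p`-monomials span -/
  span_eq_top : Submodule.span R (Set.range (pMonomialTwist p t)) = ⊤

namespace IsPBasis

variable {p} {t : ι → R}

/-- The `R`-basis of `FrobeniusTwist p R R` given by the `p`-monomials of a `p`-basis. [cite: Matsumura1987, §26] -/
def basis (h : IsPBasis p t) : Module.Basis (ι → Fin p) R (FrobeniusTwist p R R) :=
  Module.Basis.mk h.linearIndependent (by rw [h.span_eq_top])

/-- The basis vectors are the `p`-monomials. [folklore] -/
@[simp] theorem basis_apply (h : IsPBasis p t) (α : ι → Fin p) : h.basis α = pMonomialTwist p t α := by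
  rw [basis, Module.Basis.mk_apply]

/-- The basis vectors are the `p`-monomials (as a function). [folklore] -/
theorem coe_basis (h : IsPBasis p t) : ⇑h.basis = pMonomialTwist p t :=
  funext h.basis_apply

/-- The coordinate `c_α` of `x = ∑_α c_α ^ p * t^α`. [folklore] -/
def coord (h : IsPBasis p t) (x : R) (α : ι → Fin p) : R :=
  h.basis.repr (FrobeniusTwist.of p R x) α

/-- **Expansion in a `p`-basis**: `x = ∑_α (coord x α) ^ p * t^α` (a finite sum over all exponents when `ι` is
finite and decidable). [cite: Matsumura1987, §26] -/
theorem sum_coord_pow_mul_pMonomial [DecidableEq ι] (h : IsPBasis p t) (x : R) :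
    ∑ α, h.coord x α ^ p * pMonomial p t α = x := by
  have key := h.basis.sum_repr (FrobeniusTwist.of p R x)
  apply (FrobeniusTwist.of p R).injective
  rw [← key, map_sum]
  refine Finset.sum_congr rfl fun α _ => ?_
  rw [h.basis_apply, coord, pMonomialTwist, FrobeniusTwist.smul_of_eq_of_pow_mul]

/-- Coordinates of a `p`-monomial: `coord (t^α) = Pi.single α 1`-style (Kronecker). [folklore] -/
theorem coord_pMonomial [DecidableEq ι] (h : IsPBasis p t) (α β : ι → Fin p) :
    h.coord (pMonomial p t α) β = if β = α then 1 else 0 := by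
  rw [coord, ← pMonomialTwist, ← h.basis_apply, h.basis.repr_self, Finsupp.single_apply]
  simp only [eq_comm]

/-- Coordinates are additive. [folklore] -/
theorem coord_add (h : IsPBasis p t) (x y : R) (α : ι → Fin p) :
    h.coord (x + y) α = h.coord x α + h.coord y α := by
  simp only [coord, map_add, Finsupp.add_apply]

/-- Coordinates are linear over `p`-th powers: `coord (c^p x) = c * coord x`. [folklore] -/
theorem coord_pow_mul (h : IsPBasis p t) (c x : R) (α : ι → Fin p) :
    h.coord (c ^ p * x) α = c * h.coord x α := by
  rw [coord, coord, ← FrobeniusTwist.smul_of_eq_of_pow_mul, map_smul, Finsupp.smul_apply, smul_eq_mul]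

/-- **Induction principle of a `p`-basis**: a predicate that holds on `p`-monomials and is closed under
addition and under `x ↦ c ^ p * x` holds on all of `R`. [folklore] -/
theorem induction_on [DecidableEq ι] (h : IsPBasis p t) {P : R → Prop} (x : R)
    (monomial : ∀ α, P (pMonomial p t α)) (add : ∀ x y, P x → P y → P (x + y))
    (pow_mul : ∀ (c x : R), P x → P (c ^ p * x)) (zero : P 0) : P x := by
  rw [← h.sum_coord_pow_mul_pMonomial x]
  induction (Finset.univ : Finset (ι → Fin p)) using Finset.induction_on with
  | empty => simpa using zero
  | insert a s ha ih =>
    rw [Finset.sum_insert ha]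
    exact add _ _ (pow_mul _ _ (monomial a)) ih

/-- **Extensionality on `p`-monomials**: two `R`-linear maps out of the twist `FrobeniusTwist p R R` (i.e. two
additive maps `f, g : R → M` with `f (c^p x) = c • f x`) that agree on the `p`-monomials are equal. [folklore] -/
theorem linearMap_ext (h : IsPBasis p t) {M : Type*} [AddCommGroup M] [Module R M]
    {f g : FrobeniusTwist p R R →ₗ[R] M} (hfg : ∀ α, f (pMonomialTwist p t α) = g (pMonomialTwist p t α)) :
    f = g :=
  h.basis.ext fun α => by rw [h.basis_apply]; exact hfg α

/-- **A ring with a `p`-basis has injective Frobenius**: if `c ^ p = 0` then `c • t^0 = 0` in the twist, and linear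
independence of the basis vector `t^0` forces `c = 0`. [folklore] -/
theorem pow_eq_zero_imp (h : IsPBasis p t) {c : R} (hc : c ^ p = 0) : c = 0 := by
  classical
  have h1 : c • h.basis 0 = 0 := by
    rw [h.basis_apply, pMonomialTwist, FrobeniusTwist.smul_of_eq_of_pow_mul, hc, zero_mul, map_zero]
  have h2 := h.basis.linearIndependent
  rw [Fintype.linearIndependent_iff] at h2
  have h3 := h2 (Pi.single 0 c) (by
    rw [Fintype.sum_eq_single (0 : ι → Fin p) (fun α hα => by rw [Pi.single_eq_of_ne hα, zero_smul])]
    rw [Pi.single_eq_same, h1]) 0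
  rwa [Pi.single_eq_same] at h3

/-- The Frobenius of a ring with a `p`-basis is injective. [folklore] -/
theorem frobenius_injective (h : IsPBasis p t) : Function.Injective (frobenius R p) := by
  intro a b hab
  rw [frobenius_def, frobenius_def] at hab
  have : (a - b) ^ p = 0 := by rw [sub_pow_char, hab, sub_self]
  exact sub_eq_zero.1 (h.pow_eq_zero_imp this)

/-- **A ring with a `p`-basis is reduced.** [folklore] -/
theorem isReduced (h : IsPBasis p t) : IsReduced R :=
  (isReduced_iff_pow_one_lt (R := R) p hp.out.one_lt).2 fun _ hx => h.pow_eq_zero_imp hx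

/-- Uniqueness of `p`-expansions: if `∑_α c_α ^ p * t^α = ∑_α c'_α ^ p * t^α` then `c = c'`. [folklore] -/
theorem pow_expansion_unique [DecidableEq ι] (h : IsPBasis p t) (c c' : (ι → Fin p) → R)
    (hcc' : ∑ α, c α ^ p * pMonomial p t α = ∑ α, c' α ^ p * pMonomial p t α) : c = c' := by
  have key : ∀ d : (ι → Fin p) → R,
      FrobeniusTwist.of p R (∑ α, d α ^ p * pMonomial p t α) = ∑ α, d α • h.basis α := fun d => by
    rw [map_sum]
    refine Finset.sum_congr rfl fun α _ => ?_
    rw [h.basis_apply, pMonomialTwist, FrobeniusTwist.smul_of_eq_of_pow_mul]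
  have h1 : ∑ α, c α • h.basis α = ∑ α, c' α • h.basis α := by rw [← key, ← key, hcc']
  have h2 : h.basis.repr (∑ α, c α • h.basis α) = h.basis.repr (∑ α, c' α • h.basis α) := by rw [h1]
  simp only [map_sum, map_smul, Module.Basis.repr_self, Finsupp.smul_single, smul_eq_mul, mul_one] at h2
  funext β
  have h3 := congrArg (fun f => f β) h2
  simpa [Finsupp.finsetSum_apply, Finsupp.single_apply] using h3

end IsPBasis

end Literature.NumberTheory.GaloisCohomology

end
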